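import Literature.NumberTheory.LFunctions.PretentiousDistanceFord
import Literature.NumberTheory.Sieve.PretentiousDistanceProofs
import HarnessLib

/-!
# Sifted pretentious distances away from the minimising twist (Matomäki–Radziwiłł–Tao 2015, App. A)

Topic `Literature/NumberTheory/LFunctions`.  Everything here is PROVED, conditionally on the single named fact
`zeta_bound_ford` (Ford 2002, through `PretentiousFord.pretentiousDistSq_one_twist_ge`:
`𝔻(1, n^{iu}; x)² ≥ (1/3) log log x − C_A` for `2 ≤ |u| ≤ x^A`).  No definitions, no named facts.

## What is proved and why

Let `f : ℕ → ℂ` be `1`-bounded and let `t₁` (nearly) minimise `t ↦ 𝔻(f, n^{it}; x)²` over `|t| ≤ x` (the `t₁` of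
Matomäki–Radziwiłł–Tao, proof of Proposition A.3; `t_{f,X}` of Matomäki–Radziwiłł II, Definition 1.6).  Let `f'` be ANY
"sifted copy" of `f`: `1`-bounded with `f'(p) ∈ {f(p), 0}` at every prime `p` (e.g. `f · g_𝒥 · 1_{(·,∏_{P≤p≤Q} p)=1}` for the
`2^J` functions `g_𝒥` of Matomäki–Radziwiłł 2016, Lemma 5, with the primes of `[P, Q]` removed as in their Lemma 3 /
MRT Lemma A.4).  Then (`MRT2015.pretentiousDistSq_sifted_ge_of_ford`), for `x ≥ x₀`, `|s| ≤ x`, `|s − t₁| ≥ 2`,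

  `𝔻(f', n^{is}; x)² ≥ ((√2 − 1)/6) · log log x − C`,   `(√2 − 1)/6 = 0.0690…`,

with `x₀, C` ABSOLUTE (given Ford's constant) — in particular uniform in the sifting set.  This is the lower bound that
Halász's theorem needs for the `2^J` sifted functions behind the polynomial `R_{v,H}` of Matomäki–Radziwiłł 2016, §8.3, when
their Proposition 1 is run for COMPLEX `f` on `𝒯₂ = {t : |t − t₁| ≥ (log X)^{1/16}}` (Matomäki–Radziwiłł–Tao 2015, Appendix A,
proof of Proposition A.3 and Lemma A.4: "In the region `|t − t₁| ≥ (log X)^{1/16}`, the above implies the following in exactly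
the same way as [MR]").  For real `f` the corresponding input is MR Lemma 2, uniform over all real `1`-bounded functions
(`PretentiousFord.matomakiRadziwill_lemma2_of_ford`, constant `1/12`); for complex `f` the printed argument
(`2𝔻(f, p^{it}) ≥ 𝔻(1, p^{i(t−t₁)})`, then "remove `[P,Q]`", constant `1/12 − 1/48 = 1/16`) is stated for `f` itself, while
§8.3 applies it to the sifted functions `f g_𝒥`, whose own minimisers need not be `t₁` and for which
`∑_{p ∈ ⋃_{j∈𝒥}[P_j,Q_j]} 1/p` may be as large as `(1/2) log log X`.  The theorem below supplies the missing uniformity; the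
closest printed statement is Matomäki–Radziwiłł II, Lemma 5.2(ii) (`∑_{p ≤ X, p ∉ 𝒫} Re f(p)p^{-it}/p ≤ ∑_{p≤X} 1/p −
(ρ/2) min{log log X, 3 log(|t − t_{f,X}| log X + 1)} + O(1)`, any `𝒫`, `ρ < ρ₁ = 1/3 − 2/(3π)`, i.e. constant `0.0605…`).
The constant matters: with MR's §8.3 parameters (`P = exp((log X)^{1−1/48})`, `H = (log X)^{1/48}`) the final exponent is
`5/48 − 2σ` for a saving `(log X)^{-σ}` in `R_{v,H}`, and `5/48 − 2σ ≤ −1/50` needs `σ ≥ 0.0621`; `0.0690` leaves room,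
`0.0605` would not.

## Proof (Granville–Soundararajan's device, run on the unsifted primes only)

Write `E` for the primes `p ≤ x` with `f'(p) ≠ f(p)` (so `f'(p) = 0` there), `K = ∑_{p∈E} 1/p`, and `𝔻_∁` for distances
summed over the primes `p ≤ x`, `p ∉ E` only.  Then `𝔻(f', n^{is})² = K + D²` with `D = 𝔻_∁(f, n^{is})` (a removed
prime contributes `(1 − 0)/p`).  Minimality of `t₁` for the FULL distance gives `A² := 𝔻_∁(f, n^{it₁})² ≤ D² + 2K (+1)`;
the triangle inequality on the unsifted primes gives `b := 𝔻_∁(n^{it₁}, n^{is}) ≤ A + D ≤ √(D² + 2K) + D`; and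
`b² ≥ 𝔻(1, n^{i(s−t₁)})² − 2K ≥ (1/3) log log x − C − 2K` (Vinogradov–Korobov via Ford).  Hence `D ≥ (b² − 2K)/(2b)` and
`K + D² ≥ min_K [K + (B − 4K)²₊/(4(B − 2K))] = ((√2−1)/2) B`, `B = (1/3) log log x − C`, the minimum being attained at
`K = (2 − √2)B/4` (`sifted_distance_optimisation`: `8K² − (8 − 4√2)BK + (3 − 2√2)B² = 8(K − (2−√2)B/4)² ≥ 0`).

## Status of Proposition A.3 in this library (for the dischargers of `MatomakiRadziwillTao2015_propA3`)

This file settles the uniformity question on `𝒯₂`.  The other point of the printed proof that needs more than the text —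
the range `|t − t₁| ≤ (log X)^{1/16}` for the `𝒮`-RESTRICTED polynomial, where "`F(1+it) ≪ e^{-M}M` by Halász" is false as
stated (for `f = n^{it₁}` off `E = ⋃[P_j,Q_j]` and `−n^{it₁}` on `E`, `|F(1+it₁)| ≍ e^{-M/2}`; cf. Matomäki–Radziwiłł II,
Lemma 5.3(ii),(iv)) — is NOT addressed here.  The tree's Halász theorem for block-restricted sums
(`Halasz.Restricted.norm_restr_sum_le`, halved distance `M_½ ≥ M/2`) gives `|F|² ≪ (1+M)² e^{-M}` pointwise but, with only
Halász's generic `1/T` decay in `|t − t₁|`, `∫_{|t−t₁| ≤ (log X)^{1/16}} |F|² ≪ (1+M) e^{-M/2}`, not the printed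
`(1+M)e^{-M}`; and the major-arc use of Theorem A.2 in MRT §4 (with `W = log⁵ H ≤ e^{M/4} M⁵` from the proof of Theorem 1.7)
tolerates a decay `poly(M) e^{-cM}` only for `c > 5/8`.

## References
* K. Matomäki, M. Radziwiłł, T. Tao, *An averaged form of Chowla's conjecture*, Algebra & Number Theory 9 (2015),
  Appendix A: proof of Proposition A.3 (the display `2𝔻(f, p^{it}; X) ≥ 𝔻(1, p^{i(t−t₁)})`) and Lemma A.4.
  [cite: MatomakiRadziwillTao2015, Appendix A, proof of Proposition A.3]
* K. Matomäki, M. Radziwiłł, *Multiplicative functions in short intervals II*, arXiv:2007.04290, Definition 1.6,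
  Lemma 5.2(ii) (sifted distances away from `t_{f,X}`), Lemma 5.3 (sifted Halász, factor `e^{-M/2}`).
  [cite: MatomakiRadziwill2020ShortIntervalsII, Lemma 5.2(ii)]
* K. Matomäki, M. Radziwiłł, Ann. of Math. 183 (2016), Lemmas 2, 3, 5 and §8.3.
* A. Granville, K. Soundararajan (2008), §2 — the triangle inequality (tree: `Sieve.pretentiousDist_triangle_holds`, whose
  termwise form `Sieve.sqrt_one_sub_re_mul_conj_le` is reused here on a sub-sum).

## Design choices
* The twist `n^{it}` is `fun n : ℕ => (n : ℂ) ^ ((t : ℂ) * I)`, distances are `Sieve.pretentiousDistSq`, as in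
  `Sieve.minPretentiousDistSq` / `MatomakiRadziwillTao2015_propA3`.
* `t₁` is any NEAR-minimiser with slack `1` (`𝔻(f,n^{it₁})² ≤ 𝔻(f,n^{it})² + 1` for `|t| ≤ x`), so that users need no
  compactness argument; an exact minimiser qualifies.
* The sifted copy `f'` is quantified abstractly (`f'(p) = f(p) ∨ f'(p) = 0` at primes); only prime values enter.
* `|s − t₁| ≥ 2` (rather than `≥ 1`) because the Ford-based input is stated for `|u| ≥ 2`; `|s − t₁| ≤ 2x ≤ x²` is automatic.
-/

noncomputable section

open Complex Real Finset
open scoped ComplexConjugate Classical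

namespace Literature.NumberTheory.LFunctions

namespace MRT2015

open Sieve (pretentiousDistSq)

/-! ### The elementary optimisation -/

/-- **The optimisation step.**  If `K, b ≥ 0`, `D` real, `b² ≥ B − 2K` and `b ≤ √(D² + 2K) + D`, then
`K + D² ≥ ((√2 − 1)/2) B`.  (From the hypotheses `2bD ≥ b² − 2K`, so for `B > 4K`:
`4b²(K + D²) ≥ 4b²K + (b² − 2K)² = b⁴ + 4K² ≥ 4c b²(b² + 2K) ≥ 4c b² B` with `c = (√2−1)/2`, because
`(1 − 4c) β² − 8cKβ + 4K² = ((√2 − 1)β − 2K)²`; the cases `B ≤ 0` and `B ≤ 4K` are trivial as `c ≤ 1/4`.) [folklore] -/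
theorem sifted_distance_optimisation {B K D b : ℝ} (hK : 0 ≤ K) (hb : 0 ≤ b)
    (hbB : B - 2 * K ≤ b ^ 2) (htri : b ≤ Real.sqrt (D ^ 2 + 2 * K) + D) :
    (Real.sqrt 2 - 1) / 2 * B ≤ K + D ^ 2 := by
  set c : ℝ := (Real.sqrt 2 - 1) / 2 with hc
  have hr2 : Real.sqrt 2 ^ 2 = 2 := Real.sq_sqrt (by norm_num)
  have hr0 : 0 ≤ Real.sqrt 2 := Real.sqrt_nonneg 2
  have hr1 : 1 ≤ Real.sqrt 2 := by nlinarith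
  have hr15 : Real.sqrt 2 ≤ 3 / 2 := by nlinarith
  have hc0 : 0 ≤ c := by rw [hc]; linarith
  have hc4 : c ≤ 1 / 4 := by rw [hc]; linarith
  have hD2 : 0 ≤ D ^ 2 := sq_nonneg D
  -- trivial cases `B ≤ 0` and `B ≤ 4K`
  rcases le_or_gt B 0 with hB | hB
  · nlinarith
  rcases le_or_gt B (4 * K) with hBK | hBK
  · nlinarith
  -- main case: `β := b² ≥ B − 2K > 2K ≥ 0`
  set β := b ^ 2 with hβ
  have hβK : 2 * K < β := by linarith
  have hβ0 : 0 < β := by linarith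
  -- (1) `2 b D ≥ β − 2K`
  have h1 : β - 2 * K ≤ 2 * b * D := by
    rcases le_or_gt b D with hbD | hbD
    · nlinarith
    · have h2 : b - D ≤ Real.sqrt (D ^ 2 + 2 * K) := by linarith
      have h3 : (b - D) ^ 2 ≤ D ^ 2 + 2 * K := by
        calc (b - D) ^ 2 ≤ (Real.sqrt (D ^ 2 + 2 * K)) ^ 2 :=
              pow_le_pow_left₀ (by linarith) h2 2
          _ = D ^ 2 + 2 * K := Real.sq_sqrt (by positivity)
      nlinarith
  -- (2) square it: `(β − 2K)² ≤ 4 β D²`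
  have h4 : (β - 2 * K) ^ 2 ≤ 4 * β * D ^ 2 := by
    calc (β - 2 * K) ^ 2 ≤ (2 * b * D) ^ 2 := pow_le_pow_left₀ (by linarith) h1 2
      _ = 4 * β * D ^ 2 := by rw [hβ]; ring
  -- (3) the quadratic inequality `4c β (β + 2K) ≤ β² + 4K²`
  have h6 : 4 * c * β * (β + 2 * K) ≤ β ^ 2 + 4 * K ^ 2 := by
    have hsq : 0 ≤ ((Real.sqrt 2 - 1) * β - 2 * K) ^ 2 := sq_nonneg _
    rw [hc]
    nlinarith
  -- (4) combine and divide by `4β > 0`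
  have h7 : 4 * c * β * B ≤ 4 * c * β * (β + 2 * K) := by
    have hle : B ≤ β + 2 * K := by linarith
    have hnn : 0 ≤ 4 * c * β := by positivity
    nlinarith
  have h8 : 4 * β * (c * B) ≤ 4 * β * (K + D ^ 2) := by nlinarith
  exact le_of_mul_le_mul_left h8 (by positivity)

/-! ### Twists `n^{it}` -/

/-- `‖n^{it}‖ ≤ 1` for all `n : ℕ` (value `1` for `n ≥ 1`; at `n = 0` Mathlib's `0 ^ w ∈ {0, 1}`). [folklore] -/
theorem norm_natCast_cpow_mul_I_le_one (n : ℕ) (t : ℝ) : ‖(n : ℂ) ^ ((t : ℂ) * I)‖ ≤ 1 := by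
  rcases Nat.eq_zero_or_pos n with rfl | hn
  · rcases eq_or_ne ((t : ℂ) * I) 0 with h0 | h0
    · simp [h0]
    · simp [Complex.zero_cpow h0]
  · rw [Complex.norm_natCast_cpow_of_pos hn]
    simp

/-- `conj (n^w) = n^{conj w}` for `n : ℕ` (a local copy of a lemma several tree files keep private). [folklore] -/
private theorem conj_natCast_cpow' (n : ℕ) (w : ℂ) : conj ((n : ℂ) ^ w) = (n : ℂ) ^ (conj w) := by
  have h := Complex.conj_cpow (n : ℂ) (conj w) (by rw [Complex.natCast_arg]; exact Real.pi_ne_zero.symm)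
  rw [Complex.conj_conj, Complex.conj_natCast] at h
  exact h.symm

/-- `p^{it₁} · conj(p^{is}) = conj(p^{i(s − t₁)})` for `p ≠ 0`. [folklore] -/
theorem cpow_mul_conj_cpow_eq {p : ℕ} (hp : p ≠ 0) (t₁ s : ℝ) :
    (p : ℂ) ^ ((t₁ : ℂ) * I) * conj ((p : ℂ) ^ ((s : ℂ) * I)) =
      conj ((p : ℂ) ^ ((((s - t₁ : ℝ)) : ℂ) * I)) := by
  have hp0 : (p : ℂ) ≠ 0 := Nat.cast_ne_zero.mpr hp
  rw [conj_natCast_cpow', conj_natCast_cpow', ← Complex.cpow_add _ _ hp0]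
  congr 1
  simp only [map_mul, Complex.conj_ofReal, Complex.conj_I]
  push_cast
  ring

/-! ### The theorem -/

/-- **Sifted pretentious distances away from the minimising twist.**  Assume Ford's bound `zeta_bound_ford`.
There are absolute `x₀ ≥ 3` and `C` such that for `x ≥ x₀`: if `f, f' : ℕ → ℂ` are `1`-bounded with
`f'(p) ∈ {f(p), 0}` for every prime `p`, if `|t₁| ≤ x` satisfies `𝔻(f, n^{it₁}; x)² ≤ 𝔻(f, n^{it}; x)² + 1` for all
`|t| ≤ x`, and if `|s| ≤ x`, `|s − t₁| ≥ 2`, then `𝔻(f', n^{is}; x)² ≥ ((√2 − 1)/6) log log x − C`.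
This is Matomäki–Radziwiłł II, Lemma 5.2(ii) ("for any `𝒫 ⊂ ℙ ∩ (1, X]` and `|t| ≤ X`,
`∑_{p ≤ X, p ∉ 𝒫} Re f(p)p^{-it}/p ≤ ∑_{p ≤ X} 1/p − (ρ/2) min{log log X, 3 log(|t − t_{f,X}| log X + 1)} + O_ρ(1)`,
`ρ < ρ₁`) in the range `|t − t_{f,X}| ≥ 2` (where the `min` is `log log X`), rewritten as a lower bound for
`𝔻(f 1_{p ∉ 𝒫}, n^{it}; X)² = ∑_{p≤X} 1/p − ∑_{p ∉ 𝒫} Re f(p)p^{-it}/p`, with two differences, both on the side of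
strength: the constant is `(√2 − 1)/6 = 0.0690…` (theirs: `ρ/2 < ρ₁/2 = 0.0605…`; here the input is the
Vinogradov–Korobov bound `𝔻(1, n^{iu})² ≥ (1/3) log log x − C` of Matomäki–Radziwiłł 2016, Lemma 2, and the two bounds of
their proof are combined by `sifted_distance_optimisation` instead of averaged), and `t_{f,X}` may be a near-minimiser.
It is the uniform input for the `2^J` sifted functions of Matomäki–Radziwiłł–Tao 2015, Appendix A (Lemma A.4 as used in
§8.3 of Matomäki–Radziwiłł 2016 for complex `f`).
[cite: MatomakiRadziwill2020ShortIntervalsII, Lemma 5.2(ii)] -/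
theorem pretentiousDistSq_sifted_ge_of_ford (hF : zeta_bound_ford) :
    ∃ x₀ C : ℝ, 3 ≤ x₀ ∧ ∀ x : ℝ, x₀ ≤ x →
      ∀ f f' : ℕ → ℂ, (∀ n, ‖f n‖ ≤ 1) → (∀ n, ‖f' n‖ ≤ 1) →
      (∀ p : ℕ, p.Prime → f' p = f p ∨ f' p = 0) →
      ∀ t₁ : ℝ, |t₁| ≤ x →
      (∀ t : ℝ, |t| ≤ x →
          pretentiousDistSq f (fun n : ℕ => (n : ℂ) ^ ((t₁ : ℂ) * I)) x ≤
            pretentiousDistSq f (fun n : ℕ => (n : ℂ) ^ ((t : ℂ) * I)) x + 1) →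
      ∀ s : ℝ, |s| ≤ x → 2 ≤ |s - t₁| →
        (Real.sqrt 2 - 1) / 6 * Real.log (Real.log x) - C ≤
          pretentiousDistSq f' (fun n : ℕ => (n : ℂ) ^ ((s : ℂ) * I)) x := by
  obtain ⟨x₀, C, hx₀, hVK⟩ := PretentiousFord.pretentiousDistSq_one_twist_ge hF (A := 2) two_pos
  set c : ℝ := (Real.sqrt 2 - 1) / 2 with hc
  refine ⟨x₀, c * C - c + 1 / 2, hx₀, ?_⟩
  intro x hx f f' hf hf' hmask t₁ ht₁ hmin s hs hst
  have hx3 : 3 ≤ x := hx₀.trans hx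
  -- the twists and the summands
  set τ : ℝ → ℕ → ℂ := fun t n => (n : ℂ) ^ ((t : ℂ) * I) with hτ
  have hτ1 : ∀ t n, ‖τ t n‖ ≤ 1 := fun t n => norm_natCast_cpow_mul_I_le_one n t
  have h11 : ∀ n, ‖(1 : ℕ → ℂ) n‖ ≤ 1 := fun n => by simp
  set T : (ℕ → ℂ) → (ℕ → ℂ) → ℕ → ℝ := fun a b p => (1 - (a p * conj (b p)).re) / (p : ℝ) with hT
  have hT0 : ∀ a b : ℕ → ℂ, (∀ n, ‖a n‖ ≤ 1) → (∀ n, ‖b n‖ ≤ 1) → ∀ p, 0 ≤ T a b p :=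
    fun a b ha hb p => Sieve.pretentiousDistSq_summand_nonneg ha hb p
  have hT2 : ∀ a b : ℕ → ℂ, (∀ n, ‖a n‖ ≤ 1) → (∀ n, ‖b n‖ ≤ 1) → ∀ p, T a b p ≤ 2 / (p : ℝ) := by
    intro a b ha hb p
    refine div_le_div_of_nonneg_right ?_ (Nat.cast_nonneg p)
    have h1 : |(a p * conj (b p)).re| ≤ ‖a p * conj (b p)‖ := Complex.abs_re_le_norm _
    have h2 : ‖a p * conj (b p)‖ ≤ 1 := by
      rw [norm_mul, Complex.norm_conj]
      calc ‖a p‖ * ‖b p‖ ≤ 1 * 1 := mul_le_mul (ha p) (hb p) (norm_nonneg _) zero_le_one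
        _ = 1 := one_mul 1
    have := (abs_le.1 (h1.trans h2)).1
    linarith
  -- the prime sets: `S` all primes `≤ x`, `Eo` those with `f' = f`, `E` the removed ones
  set S := Nat.primesLE ⌊x⌋₊ with hS
  set Eo := S.filter (fun p => f' p = f p) with hEo
  set E := S.filter (fun p => ¬ f' p = f p) with hE
  set K : ℝ := ∑ p ∈ E, (1 : ℝ) / p with hK
  have hK0 : 0 ≤ K := Finset.sum_nonneg fun p _ => by positivity
  have hsplit : ∀ a b : ℕ → ℂ, pretentiousDistSq a b x = ∑ p ∈ Eo, T a b p + ∑ p ∈ E, T a b p := by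
    intro a b
    rw [Sieve.pretentiousDistSq, ← Finset.sum_filter_add_sum_filter_not S (fun p => f' p = f p)]
  have hEsum0 : ∀ a b : ℕ → ℂ, (∀ n, ‖a n‖ ≤ 1) → (∀ n, ‖b n‖ ≤ 1) → 0 ≤ ∑ p ∈ E, T a b p :=
    fun a b ha hb => Finset.sum_nonneg fun p _ => hT0 a b ha hb p
  have hEsum2 : ∀ a b : ℕ → ℂ, (∀ n, ‖a n‖ ≤ 1) → (∀ n, ‖b n‖ ≤ 1) → ∑ p ∈ E, T a b p ≤ 2 * K := by
    intro a b ha hb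
    calc ∑ p ∈ E, T a b p ≤ ∑ p ∈ E, 2 / (p : ℝ) := Finset.sum_le_sum fun p _ => hT2 a b ha hb p
      _ = 2 * K := by
          rw [hK, Finset.mul_sum]
          exact Finset.sum_congr rfl fun p _ => by ring
  have hmemE : ∀ p ∈ E, p.Prime ∧ f' p = 0 := by
    intro p hp
    rw [hE, Finset.mem_filter, hS, Nat.mem_primesLE] at hp
    rcases hmask p hp.1.2 with h | h
    · exact (hp.2 h).elim
    · exact ⟨hp.1.2, h⟩
  have hmemEo : ∀ p ∈ Eo, p.Prime ∧ f' p = f p := by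
    intro p hp
    rw [hEo, Finset.mem_filter, hS, Nat.mem_primesLE] at hp
    exact ⟨hp.1.2, hp.2⟩
  -- (a) `𝔻(f', n^{is})² = D2 + K`
  set D2 : ℝ := ∑ p ∈ Eo, T f (τ s) p with hD2
  have hD20 : 0 ≤ D2 := Finset.sum_nonneg fun p _ => hT0 f (τ s) hf (hτ1 s) p
  have ha : pretentiousDistSq f' (τ s) x = D2 + K := by
    rw [hsplit, hD2, hK]
    congr 1
    · refine Finset.sum_congr rfl fun p hp => ?_
      simp only [hT, (hmemEo p hp).2]
    · refine Finset.sum_congr rfl fun p hp => ?_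
      simp only [hT, (hmemE p hp).2, zero_mul, Complex.zero_re, sub_zero]
  -- (b) minimality: `A2 ≤ D2 + 2K + 1`
  set A2 : ℝ := ∑ p ∈ Eo, T f (τ t₁) p with hA2
  have hA20 : 0 ≤ A2 := Finset.sum_nonneg fun p _ => hT0 f (τ t₁) hf (hτ1 t₁) p
  have hb : A2 ≤ D2 + 2 * K + 1 := by
    have h := hmin s hs
    change pretentiousDistSq f (τ t₁) x ≤ pretentiousDistSq f (τ s) x + 1 at h
    rw [hsplit, hsplit f (τ s)] at h
    have h1 := hEsum0 f (τ t₁) hf (hτ1 t₁)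
    have h2 := hEsum2 f (τ s) hf (hτ1 s)
    rw [← hA2, ← hD2] at h
    linarith
  -- (c) the triangle inequality on the unsifted primes: `√b2 ≤ √A2 + √D2`
  set b2 : ℝ := ∑ p ∈ Eo, T (τ t₁) (τ s) p with hb2
  have hb20 : 0 ≤ b2 := Finset.sum_nonneg fun p _ => hT0 (τ t₁) (τ s) (hτ1 t₁) (hτ1 s) p
  have hA2' : ∑ p ∈ Eo, T (τ t₁) f p = A2 := by
    rw [hA2]
    refine Finset.sum_congr rfl fun p _ => ?_
    simp only [hT]
    rw [← Complex.conj_re (τ t₁ p * conj (f p)), map_mul, Complex.conj_conj, mul_comm]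
  have hc' : Real.sqrt b2 ≤ Real.sqrt A2 + Real.sqrt D2 := by
    rw [← hA2', hb2, hD2]
    refine Sieve.sqrt_sum_le_sqrt_sum_add_sqrt_sum Eo (hT0 _ _ (hτ1 t₁) (hτ1 s)) (hT0 _ _ (hτ1 t₁) hf)
      (hT0 _ _ hf (hτ1 s)) fun p _ => ?_
    simp only [hT]
    rw [Real.sqrt_div' _ (Nat.cast_nonneg p), Real.sqrt_div' _ (Nat.cast_nonneg p),
      Real.sqrt_div' _ (Nat.cast_nonneg p), ← add_div]
    exact div_le_div_of_nonneg_right (Sieve.sqrt_one_sub_re_mul_conj_le (hτ1 t₁ p) (hf p) (hτ1 s p))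
      (Real.sqrt_nonneg _)
  -- (d) `b2 ≥ 𝔻(1, n^{i(s−t₁)})² − 2K ≥ (1/3) log log x − C − 2K`
  have hu2 : (2 : ℝ) ≤ |s - t₁| := hst
  have huA : |s - t₁| ≤ x ^ (2 : ℝ) := by
    rw [Real.rpow_two]
    calc |s - t₁| ≤ |s| + |t₁| := abs_sub s t₁
      _ ≤ x + x := add_le_add hs ht₁
      _ ≤ x ^ 2 := by nlinarith
  have hVKu := hVK x hx (s - t₁) hu2 huA
  change Real.log (Real.log x) / 3 - C ≤ pretentiousDistSq 1 (τ (s - t₁)) x at hVKu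
  have hd : Real.log (Real.log x) / 3 - C - 2 * K ≤ b2 := by
    rw [hsplit] at hVKu
    have h2 := hEsum2 1 (τ (s - t₁)) h11 (hτ1 _)
    have heq : ∑ p ∈ Eo, T 1 (τ (s - t₁)) p = b2 := by
      rw [hb2]
      refine Finset.sum_congr rfl fun p hp => ?_
      have hp0 : p ≠ 0 := (hmemEo p hp).1.ne_zero
      simp only [hT, hτ, Pi.one_apply, one_mul]
      rw [cpow_mul_conj_cpow_eq hp0]
    linarith
  -- (e) the optimisation with `K + 1/2`, `D = √D2`, `b = √b2`, `B = (1/3) log log x − C + 1`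
  have hopt := sifted_distance_optimisation (B := Real.log (Real.log x) / 3 - C + 1) (K := K + 1 / 2)
    (D := Real.sqrt D2) (b := Real.sqrt b2) (by linarith) (Real.sqrt_nonneg _)
    (by rw [Real.sq_sqrt hb20]; linarith)
    (by
      have e : Real.sqrt D2 ^ 2 + 2 * (K + 1 / 2) = D2 + 2 * K + 1 := by rw [Real.sq_sqrt hD20]; ring
      rw [e]
      exact hc'.trans (add_le_add (Real.sqrt_le_sqrt hb) le_rfl))
  rw [Real.sq_sqrt hD20] at hopt
  change pretentiousDistSq f' (τ s) x ≥ _  -- orient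
  rw [ha]
  have e6 : (Real.sqrt 2 - 1) / 6 * Real.log (Real.log x) = c * (Real.log (Real.log x) / 3) := by
    rw [hc]; ring
  rw [e6]
  nlinarith [hopt]

end MRT2015

end Literature.NumberTheory.LFunctions
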